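import Literature.MathematicalPhysics.QuantumFieldTheory.Balaban1983to89.B6Prop27KLevelV1
import Literature.MathematicalPhysics.QuantumFieldTheory.Balaban1983to89.B6RandomWalkHom
import HarnessLib

/-!
# `Balaban1983to89.B6Cor28KLevelV1` — T. Bałaban, *Propagators and renormalization transformations for lattice gauge theories. II*,
Comm. Math. Phys. **96** (1984) 223–250 [Balaban1984PropagatorsII], **Corollary 2.8, the entry `|H(b, c)|` of (2.150)–(2.151) p. 249 AT k LEVELS
for the genuine `H = GQ*(QGQ*)⁻¹ = GE ∘ QsE ∘ EE (domT hN D hk)`** on ROUTE V's V1 torus (B6-CLOSURE §5 item 18; owner r03): THE COMPOSITION STEP, generic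
in the left factor (any operator `T` of the fine bond functions with a majorant `F(y)·e^{−δ₃d_T}`), from a (2.136)-type majorant and (2.149)-type entries as
DISPLAYED HYPOTHESES, and (§7) THE ENTRY `|H(b,c)|` OF (2.151) FOR THE GENUINE `H` MODULO THE LEVEL-WEIGHTED (2.147); the hypothesis-free k-level statements
(2.151)₁,₂ (inputs: the landed (2.136)₁,₂ and W1's (2.149)) are the sequel `B6Cor28EntriesKLevelV1`.

HONEST FRAMING (programme rule): statement-level skeleton of published theorems with citation tags; proofs where landed; nothing here
is a claim about the Yang–Mills mass gap.

WHAT IS PRINTED (p. 249): «A kernel of the operator H, (HB)(b) = Σ_{c∈𝔅}(L^{j(c)}η)^d H(b,c)B(c), (2.150) satisfies the inequality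
|H(b,c)|, |(∇H)(b,c)|, ‖(ζ∇H)(·,c)‖_α ≤ O(1)[1, (L^jη)^{−1}, (L^jη)^{−1−α}(‖ζ‖^ξ_α + |ζ|)](L^{j′}η)^{−d}e^{−δ₅d(y,c₋)}, (1.151)[sic] b ∈ Δ(y) or
supp ζ ⊂ Δ(y), y ∈ Λ_j, c₋ ∈ Λ_{j′}. This Corollary and Proposition 2.6 are our main technical results.»  NO PROOF is printed; the evident
route (cell GAPS C-B6-5; the tree's abstract `B6Cor28`: "Prop. 2.6 ∘ Prop. 2.7 via Lemma 2.1, scale-mismatch powers absorbed as in (2.88)") is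
followed here on the genuine k-level objects: `H = GQ*(QGQ*)⁻¹` ((2.130) p. 246), the entries of `GQ*` from a (2.136)-type majorant of the left factor
(`abs_apply_qwt_le_gen`, the generic twin of `B6Ineq2142KLevelV1.abs_apply_qwt_le`), the entries of `(QGQ*)⁻¹` in the (2.149) shape of
`B6Prop27KLevelV1.prop27_kLevel` (a hypothesis here), the mismatched level factors of the intermediate index bond absorbed by the torus (2.60)
(`B6Prop23MultiLevelTorus.levelGap_le_distT`) for `M` large, and the sum over the intermediate point done by (2.63) with two factors
(`B6Geom246MultiLevelTorus.lemma21_torus`).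

## WHAT THIS FILE CERTIFIES (kernel-checked, sorry-free, standard axioms; lattice units, `D = d + 1`, `L = ℓ + 1`; THEOREMS ONLY)

* §1 dictionary: `toLp_eq_sum_single`, `onFun_apply_eq_sum`, `onFun_comp`, and `hasMajorantHom_of_entries` (entries summable over the block fibres
  give a two-space majorant, (2.51));
* §2 `H := GE ∘ QsE ∘ EE` (written out; no new definition): `QE_comp_H` (`QH = I`), and THE ENTRIES THROUGH THE INTERMEDIATE INDEX BOND
  `comp_QsE_EE_single_apply`: `(T Q*(QGQ*)⁻¹e_c)(f) = Σ_{c′} ⟪e_{c′}, (QGQ*)⁻¹e_c⟫·(T q_{c′})(f)` for any `T`, `H_single_apply` for `T = G`;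
* §3 **THE LEVEL ABSORPTION ON THE TORUS** `powL_lgap_le`: `(L^p)^{|j−j′|} ≤ L^p·e^{ε d_T(y,y′)}` once `L^p·e^{−ε(R·L·M_h − 1)} ≤ 1` ((2.60) in the
  level-gap form `(R·L·M_h − 1)(|j − j′| − 1)₊ ≤ d_T`), and the level factors `pref(y) ≤ (L²)^{|j−j′|}pref(y′)`, `Λ²_{c′} ≤ (L^{D+2})^{|j′−j|}Λ²_c`,
  `(L^{j′D})⁻¹Λ_{c′}⁻¹ = Λ_{c′}/pref(β c′)`, `Λ_{c′} ≤ L^{D+2}e^{(δ/2)d_T}Λ_c` under the threshold;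
* §4 `abs_apply_qwt_le_gen` (`|(T q_{c′})(f)| ≤ 2L^D·e^{δ₃(L+2)}·(L^{j′D})⁻¹·F(y(f))·e^{−δ₃d_T(y(f), β c′)}`), the fibre sum `Σ_{c′} g(β c′) ≤ 2D·Σ_{y″} g(y″)`
  and (2.63) with two factors;
* §5 **`comp_entry_le`** (the composition step, generic): a majorant `F(y)·e^{−δ₃d_T}` of `T`, (2.149)-entries `Λ⁻¹Λ⁻¹·C_γ·e^{−δ d_T(β·,β·)}` of `(QGQ*)⁻¹`
  (`0 < δ ≤ δ₃`), the threshold `L^{D+2}e^{−(δ/2)(R·L·M_h−1)} ≤ 1` and (2.63) `Ineq263With c (geomT D) (δ/2) α′` give, for EVERY index bond `c` and fine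
  bond `f`: `|(TQ*(QGQ*)⁻¹e_c)(f)| ≤ (F(y(f))/pref(y(f)))·C_γ·2L^D·e^{δ₃(L+2)}·L^{D+4}·2D·c²·e^{−(1−α′)(δ/2)·d_T(y(f), β c)}` — only the OUTPUT factor
  `F/pref = F/(L^jη)²` survives (print's `[1, (L^jη)^{−1}, …]`), `H_entry_le` = the case `T = G`, `F = A·pref`;
* §6 the two thresholds met for `M` large: `absorb_threshold` (`L^{D+2}e^{−(δ/2)N} ≤ 1` for `N ≥ ⌈2(d+3)L/δ⌉ + 1`), `theta_threshold` (the (2.59)-shape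
  condition of `lemma21_torus` at rate `δ/2`, `α′ = 1/16`, for `N₂ = ⌈64DL/δ⌉ + 1`), `two_le_RMh`;
* §7 **`cor28_kLevel_H_of_2147`** = COROLLARY 2.8 (2.151)₁ `|(He_c)(f)| ≤ C·e^{−δ₅d_T(y(f), β c)}` (and the two-space majorant `2D·C·e^{−δ₅d_T}` of `H`)
  AT k LEVELS for the genuine `H`, MODULO THE LEVEL-WEIGHTED (2.147) `γΣ_iΛ_i²v_i² ≤ ⟪Q*v, GQ*v⟫` (binders of `B6Prop27KLevelV1.prop27_kLevel` verbatim, `γ > 0`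
  free, constants depending on it; inputs BY NAME: the landed (2.136)₁ `B6Line3CubeV1.prop26_2136_kLevel_unconditional` and `B6Prop27KLevelV1.prop27_kLevel`).

## HONEST SCOPE

(1) The (2.136)-majorant and the (2.149)-entries are HYPOTHESES of `comp_entry_le`/`H_entry_le`, and (2.147) is the ONE displayed hypothesis of §7 (discharged in the sequel `B6Cor28EntriesKLevelV1` by
`B6Line3CubeV1.prop26_2136_kLevel_unconditional`, p38's `B6Prop26GradKLevelV1.prop26_2136_grad_kLevel_unconditional` and W1's
`B6QGQCoerciveKLevelV1.prop27_kLevel_unconditional`); the Hölder entry of (2.151) has no k-level (2.137) in the tree.  (2) `d(y, c₋)` := p21's torus graph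
distance (2.46) between the block `blkV1 f` of the fine bond and the carrier block `β c`; flat `ℓ²` entries.  (3) Rates and constants ours (print: «O(1)»,
«δ₅» depending on `d, L`).  (4) The expansion form of `H` is not re-derived.  NOT summit progress.  Unit `lit-balaban-r03` (gen 23–24), 2026-08-23.
-/

namespace Literature.MathematicalPhysics.QuantumFieldTheory.Balaban1983to89.B6Cor28KLevelV1

open scoped InnerProductSpace
open LatticeFieldCalculus
open B6SectAOperatorsV1 (QE QsE BondIdx BondIdxSpace)
open B6SectAVectorModelV1 (GE EE comp_EE)
open B6Ineq2133TwoScaleV1 (onFun onFun_apply)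
open B6RandomWalk (HasMajorant BlockSupp delta3 chain chain_zero chain_succ blockPiece blockSupp_blockPiece sum_blockPiece)
open B6RandomWalkHom (HasMajorantHom)
open BalabanImbrieJaffe1984to88.BIJ85AxialPropagator411 (BondSpace)
open B5Eq118OneStroke (iterBlock iterBlockOf mem_iterBlock)
open B6MultiLevelBoxOperator (N0)
open B6MultiLevelTorusOperator (TDomains)
open B6GlobalChartV1 (PV domT blkV1 toBox)
open B6Geom246MultiLevelBox (bset blkOf)
open B6Geom246MultiLevelTorus (geomT bondT lemma21_torus connectedT)
open B6Ineq281MultiLevelBox (lgap)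
open B6Ineq261LevelGap (K261 K261_nonneg theta_lt_one_of_log)
open B6Lemma21Repaired (Ineq263With)
open B6Prop23MultiLevelTorus (levelGap_le_distT)
open B8Ineq192MultiLevelTorus (symmT)
open B6Prop26KLevelSkeletonV1 (pref pref_nonneg)
open B6Prop26KLevelAssemblyV1 (distT_nonneg)
open B6Ineq2142KLevelV1 (lvl lvl_le_mK β beta_level qwt qwt_nonneg qwt_le QsE_single_apply exists_of_qwt_ne_zero iterBlockOf_runSite_mem
  metBlocks mem_metBlocks exists_of_mem_metBlocks card_metBlocks_le geomT_dist_ends_le abs_apply_le_of_support delta3_two_mul_nonneg)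
open B6Prop27KLevelV1 (wt wt_pos lam lam_pos lam_sq card_fiber_beta_le)
open B6CubeWindowV1 (Placed GlobalBand)
open B6Cover236MultiLevelBlocks (cubes)

noncomputable section

/-! ## §1  Dictionary: coordinate expansions, composition, entries summable over the block fibres -/

section Entries

variable {g : B6.Geometry} {ι κ : Type} [Fintype ι] [DecidableEq ι]

/-- a vector of `ℓ²(ι)` is the combination of the coordinate vectors. [cite: Balaban1984PropagatorsII, (2.8) p.224, dictionary] -/
theorem toLp_eq_sum_single (μ : ι → ℝ) : WithLp.toLp 2 μ = ∑ x, μ x • EuclideanSpace.single x (1 : ℝ) := by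
  refine PiLp.ext fun v => ?_
  rw [WithLp.ofLp_sum, Finset.sum_apply]
  simp only [WithLp.ofLp_smul, Pi.smul_apply, smul_eq_mul]
  rw [Finset.sum_eq_single v (fun x _ hx => by rw [PiLp.single_apply, if_neg (Ne.symm hx), mul_zero]) (fun h => absurd (Finset.mem_univ v) h)]
  simp

/-- the bond-function reading of an operator through its entries: `(onFun S μ)(v) = Σ_x μ(x)·(S e_x)(v)`. [cite: Balaban1984PropagatorsII, (2.51) p.232, dictionary] -/
theorem onFun_apply_eq_sum [Fintype κ] (S : EuclideanSpace ℝ ι →ₗ[ℝ] EuclideanSpace ℝ κ) (μ : ι → ℝ) (v : κ) :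
    onFun S μ v = ∑ x, μ x * S (EuclideanSpace.single x (1 : ℝ)) v := by
  rw [onFun_apply, toLp_eq_sum_single, map_sum, WithLp.ofLp_sum, Finset.sum_apply]
  simp only [map_smul, WithLp.ofLp_smul, Pi.smul_apply, smul_eq_mul]

omit [Fintype ι] [DecidableEq ι] in
/-- `onFun` is multiplicative: the reading of a composite is the composite of the readings. [cite: Balaban1984PropagatorsII, (2.52) p.232, dictionary] -/
theorem onFun_comp {ν : Type} (S : EuclideanSpace ℝ κ →ₗ[ℝ] EuclideanSpace ℝ ν) (S' : EuclideanSpace ℝ ι →ₗ[ℝ] EuclideanSpace ℝ κ) :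
    onFun (S ∘ₗ S') = onFun S ∘ₗ onFun S' :=
  LinearMap.ext fun _ => rfl

/-- **ENTRIES SUMMABLE OVER THE BLOCK FIBRES GIVE A TWO-SPACE MAJORANT**: if `Σ_{x ∈ s} |(S e_x)(v)| ≤ K(blkY v, y′)` for every finite
set `s` of `x` in the fibre `blkX⁻¹(y′)` and all `v`, then `onFun S` has the majorant `K` (stated over arbitrary finite subsets of the fibre
to keep the statement free of decidability instances). [cite: Balaban1984PropagatorsII, (2.51) p.232, bookkeeping] -/
theorem hasMajorantHom_of_entries [Fintype κ] (blkX : ι → g.Site) (blkY : κ → g.Site) (S : EuclideanSpace ℝ ι →ₗ[ℝ] EuclideanSpace ℝ κ)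
    (K : g.Site → g.Site → ℝ)
    (hK : ∀ (v : κ) (y' : g.Site) (s : Finset ι), (∀ x ∈ s, blkX x = y') →
      ∑ x ∈ s, |S (EuclideanSpace.single x (1 : ℝ)) v| ≤ K (blkY v) y') :
    HasMajorantHom blkX blkY (onFun S) K := by
  classical
  intro y' μ B hμ v
  rw [onFun_apply_eq_sum]
  set s := Finset.univ.filter (fun x => blkX x = y') with hs
  have hoff : ∀ x, blkX x ≠ y' → μ x * S (EuclideanSpace.single x (1 : ℝ)) v = 0 := fun x hx => by rw [hμ.off x hx, zero_mul]
  have hsum : ∑ x, μ x * S (EuclideanSpace.single x (1 : ℝ)) v = ∑ x ∈ s, μ x * S (EuclideanSpace.single x (1 : ℝ)) v := by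
    rw [← Finset.sum_subset (Finset.subset_univ s)]
    intro x _ hx
    exact hoff x (fun h => hx (Finset.mem_filter.2 ⟨Finset.mem_univ _, h⟩))
  rw [hsum]
  have hs' : ∀ x ∈ s, blkX x = y' := fun x hx => (Finset.mem_filter.1 hx).2
  refine (Finset.abs_sum_le_sum_abs _ _).trans ?_
  calc ∑ x ∈ s, |μ x * S (EuclideanSpace.single x (1 : ℝ)) v|
      ≤ ∑ x ∈ s, B * |S (EuclideanSpace.single x (1 : ℝ)) v| :=
        Finset.sum_le_sum fun x hx => by
          rw [abs_mul]
          exact mul_le_mul_of_nonneg_right (hμ.bound x (hs' x hx)) (abs_nonneg _)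
    _ = B * ∑ x ∈ s, |S (EuclideanSpace.single x (1 : ℝ)) v| := by rw [Finset.mul_sum]
    _ ≤ B * K (blkY v) y' := mul_le_mul_of_nonneg_left (hK v y' s hs') hμ.nonneg
    _ = K (blkY v) y' * B := mul_comm _ _

end Entries

variable {d ℓ m K : ℕ} {hd : 1 ≤ d + 1} {hL : Odd (ℓ + 1) ∧ 1 < ℓ + 1}
variable {Mh k R : ℕ} {P' : Fin (d + 1) → ℕ}

/-! ## §2  `H = GQ*(QGQ*)⁻¹` and the entries through the intermediate index bond -/

section H

variable (hN : ∀ μ, N0 ℓ Mh k P' μ = (PV d ℓ m K hd hL).sitesPerDir 0) (D : TDomains d ℓ Mh k P' R) (hk : k ≤ m + K)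
variable {cf : ℝ} (hcf : cf ≠ 0) {w : BondIdx (domT hN D hk) → ℝ} (hw : ∀ i, 0 < w i)

/-- **`QH = I`** for `H = GQ*(QGQ*)⁻¹ = GE ∘ QsE ∘ EE` (the averages of `HB` are `B`). [cite: Balaban1984PropagatorsII, (2.130) p.246, (2.35) p.228] -/
theorem QE_comp_H :
    QE (domT hN D hk) ∘ₗ (GE (domT hN D hk) hcf hw ∘ₗ QsE (domT hN D hk) ∘ₗ EE (domT hN D hk) hcf hw) = LinearMap.id := by
  have h := comp_EE (domT hN D hk) hcf hw
  rw [LinearMap.comp_assoc, LinearMap.comp_assoc] at h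
  exact h

/-- `Q*e_{c′}` is the weight function `q_{c′}` (as a vector of `ℓ²`). [cite: Balaban1984PropagatorsII, (2.18) p.226 («Q*»), dictionary] -/
theorem QsE_single_eq_toLp (c' : BondIdx (domT hN D hk)) :
    QsE (domT hN D hk) (EuclideanSpace.single c' (1 : ℝ)) = WithLp.toLp 2 (qwt hN D hk c') :=
  PiLp.ext fun f => by rw [QsE_single_apply]

/-- `Q*v = Σ_{c′} v(c′)·q_{c′}` as a bond function. [cite: Balaban1984PropagatorsII, (2.18) p.226 («Q*»), dictionary] -/
theorem ofLp_QsE_eq_sum (v : BondIdxSpace (domT hN D hk)) :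
    WithLp.ofLp (QsE (domT hN D hk) v) = ∑ c', v c' • qwt hN D hk c' := by
  have hdec : v = ∑ c', v c' • EuclideanSpace.single c' (1 : ℝ) := by
    have h := toLp_eq_sum_single (WithLp.ofLp v)
    rw [WithLp.toLp_ofLp] at h
    exact h
  conv_lhs => rw [hdec]
  rw [map_sum, WithLp.ofLp_sum]
  refine Finset.sum_congr rfl fun c' _ => ?_
  rw [map_smul, QsE_single_eq_toLp, WithLp.ofLp_smul, WithLp.ofLp_toLp]

/-- **THE ENTRIES OF `T·Q*(QGQ*)⁻¹` THROUGH THE INTERMEDIATE INDEX BOND**, for any operator `T` of the fine bond functions: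
`(TQ*(QGQ*)⁻¹e_c)(f) = Σ_{c′∈𝔅} ⟪e_{c′}, (QGQ*)⁻¹e_c⟫·(Tq_{c′})(f)` — the one-intermediate-point composition of (2.150) (kernel of `TQ*` times kernel
of `(QGQ*)⁻¹`; `T = G` for `H`, `T = ∇G` for `∇H`). [cite: Balaban1984PropagatorsII, (2.150) p.249, (2.130) p.246] -/
theorem comp_QsE_EE_single_apply (T : Module.End ℝ (PBond (PV d ℓ m K hd hL) 0 → ℝ)) (c : BondIdx (domT hN D hk)) (f : PBond (PV d ℓ m K hd hL) 0) :
    (T ∘ₗ onFun (QsE (domT hN D hk) ∘ₗ EE (domT hN D hk) hcf hw)) (Pi.single c 1) f =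
      ∑ c' : BondIdx (domT hN D hk),
        ⟪EuclideanSpace.single c' (1 : ℝ), EE (domT hN D hk) hcf hw (EuclideanSpace.single c (1 : ℝ))⟫_ℝ * T (qwt hN D hk c') f := by
  have hs : WithLp.toLp 2 (Pi.single c (1 : ℝ)) = (EuclideanSpace.single c (1 : ℝ) : BondIdxSpace (domT hN D hk)) := rfl
  have hmid : onFun (QsE (domT hN D hk) ∘ₗ EE (domT hN D hk) hcf hw) (Pi.single c 1) =
      ∑ c', EE (domT hN D hk) hcf hw (EuclideanSpace.single c (1 : ℝ)) c' • qwt hN D hk c' := by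
    funext f'
    rw [onFun_apply, LinearMap.comp_apply, hs, ofLp_QsE_eq_sum]
  rw [LinearMap.comp_apply, hmid, map_sum, Finset.sum_apply]
  refine Finset.sum_congr rfl fun c' _ => ?_
  rw [map_smul, Pi.smul_apply, smul_eq_mul, EuclideanSpace.inner_single_left, map_one, one_mul]

/-- **THE ENTRIES OF `H = GQ*(QGQ*)⁻¹`**: `(He_c)(f) = Σ_{c′∈𝔅} ⟪e_{c′}, (QGQ*)⁻¹e_c⟫·(Gq_{c′})(f)`. [cite: Balaban1984PropagatorsII, (2.150) p.249, (2.130) p.246] -/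
theorem H_single_apply (c : BondIdx (domT hN D hk)) (f : PBond (PV d ℓ m K hd hL) 0) :
    (GE (domT hN D hk) hcf hw ∘ₗ QsE (domT hN D hk) ∘ₗ EE (domT hN D hk) hcf hw) (EuclideanSpace.single c (1 : ℝ)) f =
      ∑ c' : BondIdx (domT hN D hk),
        ⟪EuclideanSpace.single c' (1 : ℝ), EE (domT hN D hk) hcf hw (EuclideanSpace.single c (1 : ℝ))⟫_ℝ *
          onFun (GE (domT hN D hk) hcf hw) (qwt hN D hk c') f := by
  rw [← comp_QsE_EE_single_apply hN D hk hcf hw (onFun (GE (domT hN D hk) hcf hw)) c f, ← onFun_comp, onFun_apply, PiLp.toLp_single]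

end H

/-! ## §3  The level absorption (2.60) on the torus and the level factors of the three kernels -/

section Levels

variable (hN : ∀ μ, N0 ℓ Mh k P' μ = (PV d ℓ m K hd hL).sitesPerDir 0) (D : TDomains d ℓ Mh k P' R) (hk : k ≤ m + K)

/-- `L ≥ 1` as a real. [cite: Balaban1984PropagatorsII, (2.1) p.224, bookkeeping] -/
theorem one_le_L : (1 : ℝ) ≤ (ℓ : ℝ) + 1 := by linarith [(Nat.cast_nonneg ℓ : (0 : ℝ) ≤ ℓ)]

/-- **THE LEVEL ABSORPTION** (the quantitative «M sufficiently large» of the (2.88)-type step, from (2.60) in the level-gap form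
`(R·L·M_h − 1)·(|j − j′| − 1)₊ ≤ d_T(y, y′)`): `(L^p)^{|j−j′|} ≤ L^p·e^{ε·d_T(y,y′)}` as soon as `L^p·e^{−ε(R·L·M_h − 1)} ≤ 1`.
[cite: Balaban1984PropagatorsII, (2.60) p.234, (2.88) p.238, (2.2) p.224] -/
theorem powL_lgap_le (hMh : 1 ≤ Mh) (hP : ∀ μ, 1 ≤ P' μ) (hRM : 1 ≤ R * ((ℓ + 1) * Mh)) (p : ℕ) {ε : ℝ} (hε : 0 ≤ ε)
    (hsmall : ((ℓ : ℝ) + 1) ^ p * Real.exp (-(ε * ((R : ℝ) * (((ℓ : ℝ) + 1) * Mh) - 1))) ≤ 1)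
    (y y' : ↥(bset D.toDomains)) :
    (((ℓ : ℝ) + 1) ^ p) ^ (lgap D.toDomains y y') ≤ ((ℓ : ℝ) + 1) ^ p * Real.exp (ε * (geomT D).dist y y') := by
  set Lp : ℝ := ((ℓ : ℝ) + 1) ^ p with hLp
  set N : ℝ := (R : ℝ) * (((ℓ : ℝ) + 1) * Mh) - 1 with hNdef
  have hLp1 : 1 ≤ Lp := one_le_pow₀ (one_le_L (ℓ := ℓ))
  have hd0 := distT_nonneg (D := D) y y'
  have hgap := levelGap_le_distT D hMh hP hRM y y'
  rcases Nat.eq_zero_or_pos (lgap D.toDomains y y') with h0 | hpos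
  · rw [h0, pow_zero]
    exact hLp1.trans (le_mul_of_one_le_right (by positivity) (Real.one_le_exp (by positivity)))
  · obtain ⟨n, hn⟩ : ∃ n, lgap D.toDomains y y' = n + 1 := ⟨_, (Nat.succ_pred_eq_of_pos hpos).symm⟩
    rw [hn] at hgap ⊢
    have hn' : ((n + 1 - 1 : ℕ) : ℝ) = n := by simp
    rw [hn'] at hgap
    have hLe : Lp ≤ Real.exp (ε * N) := by
      have h1 : Lp * Real.exp (-(ε * N)) ≤ 1 := hsmall
      rw [Real.exp_neg, ← div_eq_mul_inv, div_le_one (Real.exp_pos _)] at h1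
      exact h1
    have hmono : Real.exp (ε * N) ^ n ≤ Real.exp (ε * (geomT D).dist y y') := by
      rw [← Real.exp_nat_mul, Real.exp_le_exp]
      calc (n : ℝ) * (ε * N) = ε * (N * n) := by ring
        _ ≤ ε * (geomT D).dist y y' := mul_le_mul_of_nonneg_left (by rw [hNdef]; exact hgap) hε
    calc Lp ^ (n + 1) = Lp ^ n * Lp := pow_succ _ _
      _ ≤ Real.exp (ε * N) ^ n * Lp := mul_le_mul_of_nonneg_right (pow_le_pow_left₀ (by positivity) hLe n) (by positivity)
      _ ≤ Real.exp (ε * (geomT D).dist y y') * Lp := mul_le_mul_of_nonneg_right hmono (by positivity)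
      _ = Lp * Real.exp (ε * (geomT D).dist y y') := mul_comm _ _

/-- `j ≤ |j − j′| + j′`. [cite: Balaban1984PropagatorsII, (2.60) p.234, bookkeeping] -/
theorem level_le_lgap_add (y y' : ↥(bset D.toDomains)) : y.1.1 ≤ lgap D.toDomains y y' + y'.1.1 := by
  have h : ((y.1.1 : ℤ) - y'.1.1) ≤ (lgap D.toDomains y y' : ℤ) := by
    unfold lgap; exact Int.le_natAbs
  omega

/-- `|j − j′| = |j′ − j|`. [cite: Balaban1984PropagatorsII, (2.60) p.234, bookkeeping] -/
theorem lgap_comm (y y' : ↥(bset D.toDomains)) : lgap D.toDomains y y' = lgap D.toDomains y' y := by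
  unfold lgap; rw [← Int.natAbs_neg]; congr 1; ring

/-- **THE OUTPUT FACTOR**: `pref(y) = (L^{j}η)² ≤ (L²)^{|j−j′|}·pref(y′)`. [cite: Balaban1984PropagatorsII, (2.136) p.247, (2.88) p.238, bookkeeping] -/
theorem pref_le_pow_lgap_mul (cf : ℝ) (y y' : ↥(bset D.toDomains)) :
    pref cf (D := D) y ≤ (((ℓ : ℝ) + 1) ^ 2) ^ (lgap D.toDomains y y') * pref cf (D := D) y' := by
  have hcast : (((ℓ + 1 : ℕ) : ℝ)) = (ℓ : ℝ) + 1 := by push_cast; ring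
  unfold pref
  rw [hcast, div_pow, div_pow, ← mul_div_assoc]
  by_cases hcf : cf = 0
  · simp [hcf]
  · refine div_le_div_of_nonneg_right ?_ (sq_nonneg cf)
    have hj := level_le_lgap_add D y y'
    rw [← pow_mul, ← pow_mul, ← pow_mul, ← pow_add]
    exact pow_le_pow_right₀ (one_le_L (ℓ := ℓ)) (by omega)

/-- `pref(β c) > 0` for `c_f ≠ 0`. [cite: Balaban1984PropagatorsII, (2.136) p.247, bookkeeping] -/
theorem pref_pos {cf : ℝ} (hcf : cf ≠ 0) (y : ↥(bset D.toDomains)) : 0 < pref cf (D := D) y := by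
  unfold pref
  have : (((ℓ + 1 : ℕ) : ℝ)) ^ y.1.1 / cf ≠ 0 := div_ne_zero (pow_ne_zero _ (by positivity)) hcf
  positivity

/-- `Λ²_c = pref(β c)·(L^{j(c)D})⁻¹`. [cite: Balaban1984PropagatorsII, (2.142) p.248, (2.81) p.237, bookkeeping] -/
theorem wt_eq_pref_mul (hk1 : 1 ≤ k) (cf : ℝ) (c : BondIdx (domT hN D hk)) :
    wt hN D hk cf c = pref cf (β hN D hk c) * ((((ℓ + 1 : ℕ) : ℝ) ^ (d + 1)) ^ (lvl hN D hk c))⁻¹ := by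
  unfold wt pref
  rw [beta_level hN D hk hk1]

/-- **THE MIDDLE FACTOR**: `(L^{j′D})⁻¹·Λ_{c′}⁻¹ = Λ_{c′}/pref(β c′)` (the `Q*`-weight size `L^{−j′D}` of (2.142) against the conjugation).
[cite: Balaban1984PropagatorsII, (2.142) p.248, (2.81) p.237, bookkeeping] -/
theorem volInv_mul_lamInv_eq (hk1 : 1 ≤ k) {cf : ℝ} (hcf : cf ≠ 0) (c' : BondIdx (domT hN D hk)) :
    ((((ℓ + 1 : ℕ) : ℝ) ^ (d + 1)) ^ (lvl hN D hk c'))⁻¹ * (lam hN D hk cf c')⁻¹ = lam hN D hk cf c' / pref cf (β hN D hk c') := by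
  have hlam := lam_pos hN D hk hcf c'
  have hwt := lam_sq hN D hk hcf c'
  rw [wt_eq_pref_mul hN D hk hk1] at hwt
  have hpref := pref_pos D hcf (β hN D hk c')
  -- `V⁻¹ = Λ²/pref`
  have hV : ((((ℓ + 1 : ℕ) : ℝ) ^ (d + 1)) ^ (lvl hN D hk c'))⁻¹ = lam hN D hk cf c' ^ 2 / pref cf (β hN D hk c') := by
    rw [eq_div_iff hpref.ne', hwt]; ring
  rw [hV]
  field_simp

/-- **THE INPUT FACTOR**: `Λ²_{c′} ≤ (L^{D+2})^{|j′−j|}·Λ²_c`. [cite: Balaban1984PropagatorsII, (2.81) p.237, (2.88) p.238, bookkeeping] -/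
theorem wt_le_pow_lgap_mul (hk1 : 1 ≤ k) (cf : ℝ) (c' c : BondIdx (domT hN D hk)) :
    wt hN D hk cf c' ≤ (((ℓ : ℝ) + 1) ^ (d + 3)) ^ (lgap D.toDomains (β hN D hk c') (β hN D hk c)) * wt hN D hk cf c := by
  have hcast : (((ℓ + 1 : ℕ) : ℝ)) = (ℓ : ℝ) + 1 := by push_cast; ring
  set n := lgap D.toDomains (β hN D hk c') (β hN D hk c) with hndef
  have hj' : lvl hN D hk c' ≤ n + lvl hN D hk c := by
    have := level_le_lgap_add D (β hN D hk c') (β hN D hk c)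
    rwa [beta_level hN D hk hk1, beta_level hN D hk hk1] at this
  have hj : lvl hN D hk c ≤ n + lvl hN D hk c' := by
    have := level_le_lgap_add D (β hN D hk c) (β hN D hk c')
    rwa [beta_level hN D hk hk1, beta_level hN D hk hk1, lgap_comm, ← hndef] at this
  unfold wt
  rw [hcast]
  set Lr : ℝ := (ℓ : ℝ) + 1 with hLr
  have hL1 : 1 ≤ Lr := one_le_L (ℓ := ℓ)
  have hVpos : ∀ j : ℕ, 0 < (Lr ^ (d + 1)) ^ j := fun j => by positivity
  -- the pure power inequality `L^{2j′}·(L^D)^{j} ≤ (L^{D+3})^n·L^{2j}·(L^D)^{j′}`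
  have h1 : (Lr ^ lvl hN D hk c') ^ 2 ≤ (Lr ^ 2) ^ n * (Lr ^ lvl hN D hk c) ^ 2 := by
    rw [← pow_mul, ← pow_mul, ← pow_mul, ← pow_add]
    exact pow_le_pow_right₀ hL1 (by nlinarith)
  have h2 : (Lr ^ (d + 1)) ^ lvl hN D hk c ≤ (Lr ^ (d + 1)) ^ n * (Lr ^ (d + 1)) ^ lvl hN D hk c' := by
    rw [← pow_add]
    exact pow_le_pow_right₀ (one_le_pow₀ hL1) hj
  have key : (Lr ^ lvl hN D hk c') ^ 2 * (Lr ^ (d + 1)) ^ lvl hN D hk c ≤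
      (Lr ^ (d + 3)) ^ n * (Lr ^ lvl hN D hk c) ^ 2 * (Lr ^ (d + 1)) ^ lvl hN D hk c' :=
    calc (Lr ^ lvl hN D hk c') ^ 2 * (Lr ^ (d + 1)) ^ lvl hN D hk c
        ≤ ((Lr ^ 2) ^ n * (Lr ^ lvl hN D hk c) ^ 2) * ((Lr ^ (d + 1)) ^ n * (Lr ^ (d + 1)) ^ lvl hN D hk c') :=
          mul_le_mul h1 h2 (by positivity) (by positivity)
      _ = (Lr ^ (d + 3)) ^ n * (Lr ^ lvl hN D hk c) ^ 2 * (Lr ^ (d + 1)) ^ lvl hN D hk c' := by ring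
  have aux : (Lr ^ lvl hN D hk c') ^ 2 / (Lr ^ (d + 1)) ^ lvl hN D hk c' ≤
      (Lr ^ (d + 3)) ^ n * (Lr ^ lvl hN D hk c) ^ 2 / (Lr ^ (d + 1)) ^ lvl hN D hk c := by
    rw [div_le_div_iff₀ (hVpos _) (hVpos _)]; exact key
  calc (Lr ^ lvl hN D hk c' / cf) ^ 2 * ((Lr ^ (d + 1)) ^ lvl hN D hk c')⁻¹
      = (1 / cf ^ 2) * ((Lr ^ lvl hN D hk c') ^ 2 / (Lr ^ (d + 1)) ^ lvl hN D hk c') := by rw [div_pow]; ring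
    _ ≤ (1 / cf ^ 2) * ((Lr ^ (d + 3)) ^ n * (Lr ^ lvl hN D hk c) ^ 2 / (Lr ^ (d + 1)) ^ lvl hN D hk c) :=
        mul_le_mul_of_nonneg_left aux (by positivity)
    _ = (Lr ^ (d + 3)) ^ n * ((Lr ^ lvl hN D hk c / cf) ^ 2 * ((Lr ^ (d + 1)) ^ lvl hN D hk c)⁻¹) := by rw [div_pow]; ring

/-- **THE INPUT FACTOR ABSORBED**: under `L^{D+2}·e^{−(δ/2)(R·L·M_h−1)} ≤ 1` (exponent `D + 2 = d + 3`), `Λ_{c′} ≤ L^{D+2}·e^{(δ/2)d_T(β c′, β c)}·Λ_c`.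
[cite: Balaban1984PropagatorsII, (2.60) p.234, (2.88) p.238, bookkeeping] -/
theorem lam_le_absorb (hk1 : 1 ≤ k) (hMh : 1 ≤ Mh) (hP : ∀ μ, 1 ≤ P' μ) (hRM : 1 ≤ R * ((ℓ + 1) * Mh)) {cf : ℝ} (hcf : cf ≠ 0)
    {δ : ℝ} (hδ : 0 ≤ δ)
    (hsmall : ((ℓ : ℝ) + 1) ^ (d + 3) * Real.exp (-(δ / 2 * ((R : ℝ) * (((ℓ : ℝ) + 1) * Mh) - 1))) ≤ 1)
    (c' c : BondIdx (domT hN D hk)) :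
    lam hN D hk cf c' ≤ ((ℓ : ℝ) + 1) ^ (d + 3) * Real.exp (δ / 2 * (geomT D).dist (β hN D hk c') (β hN D hk c)) * lam hN D hk cf c := by
  set Lp : ℝ := ((ℓ : ℝ) + 1) ^ (d + 3) with hLp
  have hLp1 : 1 ≤ Lp := one_le_pow₀ (one_le_L (ℓ := ℓ))
  have habs := powL_lgap_le D hMh hP hRM (d + 3) (by positivity : 0 ≤ δ / 2) hsmall (β hN D hk c') (β hN D hk c)
  have hlc := lam_pos hN D hk hcf c
  have hlc' := lam_pos hN D hk hcf c'
  set E : ℝ := Real.exp (δ / 2 * (geomT D).dist (β hN D hk c') (β hN D hk c)) with hE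
  have hE0 : 0 < E := Real.exp_pos _
  -- squares
  have hsq : lam hN D hk cf c' ^ 2 ≤ (Lp * E * lam hN D hk cf c) ^ 2 := by
    rw [lam_sq hN D hk hcf, mul_pow, mul_pow, lam_sq hN D hk hcf]
    calc wt hN D hk cf c' ≤ Lp ^ (lgap D.toDomains (β hN D hk c') (β hN D hk c)) * wt hN D hk cf c := wt_le_pow_lgap_mul hN D hk hk1 cf c' c
      _ ≤ (Lp * E) * wt hN D hk cf c := mul_le_mul_of_nonneg_right habs (wt_pos hN D hk hcf c).le
      _ ≤ (Lp ^ 2 * E ^ 2) * wt hN D hk cf c := by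
          refine mul_le_mul_of_nonneg_right ?_ (wt_pos hN D hk hcf c).le
          have hE1 : 1 ≤ E := Real.one_le_exp (mul_nonneg (by positivity) (distT_nonneg (D := D) _ _))
          have hLE : 1 ≤ Lp * E := one_le_mul_of_one_le_of_one_le hLp1 hE1
          calc Lp * E = (Lp * E) * 1 := (mul_one _).symm
            _ ≤ (Lp * E) * (Lp * E) := mul_le_mul_of_nonneg_left hLE (by positivity)
            _ = Lp ^ 2 * E ^ 2 := by ring
  exact (pow_le_pow_iff_left₀ hlc'.le (by positivity) two_ne_zero).1 hsq

end Levels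

/-! ## §4  One `Q*`-column through a majorant; the sum over the intermediate index bond -/

section Sums

variable (hN : ∀ μ, N0 ℓ Mh k P' μ = (PV d ℓ m K hd hL).sitesPerDir 0) (D : TDomains d ℓ Mh k P' R) (hk : k ≤ m + K)

/-- **`Tq_{c′}` IS SMALL AND DECAYS AWAY FROM `β c′`** for ANY operator `T` of the fine bond functions with a majorant `F(y)·e^{−δd_T}` (`F ≥ 0`):
`|(Tq_{c′})(f)| ≤ 2L^D·e^{δ(ℓ+3)}·(L^{j′D})⁻¹·F(y(f))·e^{−δ d_T(y(f), β c′)}` — the generic twin of `B6Ineq2142KLevelV1.abs_apply_qwt_le` (`F = A·pref`), same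
proof: `q_{c′}` lives on the `≤ 2L^D` blocks met by the double block of `c′`, all within `ℓ + 3` of `β c′`, with `|q_{c′}| ≤ L^{−j′D}`.
[cite: Balaban1984PropagatorsII, (2.136) p.247, (2.142) p.248, (2.150) p.249] -/
theorem abs_apply_qwt_le_gen (hk1 : 1 ≤ k) (hRM : 2 ≤ R * Mh) (hMh : 1 ≤ Mh) (hP : ∀ μ, 1 ≤ P' μ)
    {T : Module.End ℝ (PBond (PV d ℓ m K hd hL) 0 → ℝ)} {F : ↥(bset D.toDomains) → ℝ} {δ : ℝ} (hF : ∀ y, 0 ≤ F y) (hδ : 0 ≤ δ)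
    (hT : HasMajorant (g := geomT D) (blkV1 hN D) T (fun y y' => F y * Real.exp (-(δ * (geomT D).dist y y'))))
    (i' : BondIdx (domT hN D hk)) (f : PBond (PV d ℓ m K hd hL) 0) :
    |T (qwt hN D hk i') f| ≤ 2 * (((ℓ + 1 : ℕ) : ℝ)) ^ (d + 1) * Real.exp (δ * ((ℓ : ℝ) + 3)) *
      ((((ℓ + 1 : ℕ) : ℝ) ^ (d + 1)) ^ (lvl hN D hk i'))⁻¹ * F (blkV1 hN D f) *
        Real.exp (-(δ * (geomT D).dist (blkV1 hN D f) (β hN D hk i'))) := by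
  classical
  set j' := lvl hN D hk i'
  have hjm := lvl_le_mK hN D hk i'
  -- support and size of `q_{i′}`
  have hB : (0 : ℝ) ≤ ((((ℓ + 1 : ℕ) : ℝ) ^ (d + 1)) ^ j')⁻¹ := by positivity
  have hμB : ∀ f', |qwt hN D hk i' f'| ≤ ((((ℓ + 1 : ℕ) : ℝ) ^ (d + 1)) ^ j')⁻¹ := fun f' => by
    rw [abs_of_nonneg (qwt_nonneg hN D hk i' f')]; exact qwt_le hN D hk i' f'
  have hμN : ∀ f', qwt hN D hk i' f' ≠ 0 → blkV1 hN D f' ∈ metBlocks hN D hk i' := by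
    intro f' hf'
    obtain ⟨x', hx', t', ht', rfl⟩ := exists_of_qwt_ne_zero hN D hk i' hf'
    rw [mem_iterBlock] at hx'
    refine mem_metBlocks hN D hk i' ?_
    change iterBlockOf j' (runSite x' i'.1.2.dir t') = _ ∨ iterBlockOf j' (runSite x' i'.1.2.dir t') = _
    rcases iterBlockOf_runSite_mem hjm x' i'.1.2.dir ht'.le with h | h
    · exact Or.inl (h.trans hx')
    · right; rw [h, hx']; rfl
  have h0 := abs_apply_le_of_support (g := geomT D) (blkV1 hN D) hT (metBlocks hN D hk i') hB hμB hμN f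
  refine h0.trans ?_
  -- each met block is within `ℓ + 3 = L + 2` of `β i′`
  have hFpos : 0 ≤ F (blkV1 hN D f) := hF _
  have hterm : ∀ y' ∈ metBlocks hN D hk i',
      F (blkV1 hN D f) * Real.exp (-(δ * (geomT D).dist (blkV1 hN D f) y')) ≤
        F (blkV1 hN D f) * (Real.exp (δ * ((ℓ : ℝ) + 3)) * Real.exp (-(δ * (geomT D).dist (blkV1 hN D f) (β hN D hk i')))) := by
    intro y' hy'
    obtain ⟨z, hz, rfl⟩ := exists_of_mem_metBlocks hN D hk i' hy'
    refine mul_le_mul_of_nonneg_left ?_ hFpos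
    rw [← Real.exp_add]
    apply Real.exp_le_exp.2
    have hdz := geomT_dist_ends_le hN D hk hk1 hRM hMh hP i' hz
    have htri : (geomT D).dist (blkV1 hN D f) (β hN D hk i') ≤
        (geomT D).dist (blkV1 hN D f) (blkOf D.toDomains (toBox hN z)) + (geomT D).dist (blkOf D.toDomains (toBox hN z)) (β hN D hk i') := by
      have hc := connectedT (D := D) hMh hP
      change (((bondT D).dist _ _ : ℕ) : ℝ) ≤ (((bondT D).dist _ _ : ℕ) : ℝ) + (((bondT D).dist _ _ : ℕ) : ℝ)
      exact_mod_cast hc.dist_triangle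
    rw [symmT D (blkOf D.toDomains (toBox hN z)) (β hN D hk i')] at htri
    nlinarith
  have hcard : ((metBlocks hN D hk i').card : ℝ) ≤ 2 * (((ℓ + 1 : ℕ) : ℝ)) ^ (d + 1) := by
    exact_mod_cast card_metBlocks_le hN D hk hk1 hRM i'
  calc ((((ℓ + 1 : ℕ) : ℝ) ^ (d + 1)) ^ j')⁻¹ * ∑ y' ∈ metBlocks hN D hk i', F (blkV1 hN D f) * Real.exp (-(δ * (geomT D).dist (blkV1 hN D f) y'))
      ≤ ((((ℓ + 1 : ℕ) : ℝ) ^ (d + 1)) ^ j')⁻¹ * ∑ y' ∈ metBlocks hN D hk i',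
          F (blkV1 hN D f) * (Real.exp (δ * ((ℓ : ℝ) + 3)) * Real.exp (-(δ * (geomT D).dist (blkV1 hN D f) (β hN D hk i')))) :=
        mul_le_mul_of_nonneg_left (Finset.sum_le_sum hterm) hB
    _ = ((((ℓ + 1 : ℕ) : ℝ) ^ (d + 1)) ^ j')⁻¹ * ((metBlocks hN D hk i').card *
          (F (blkV1 hN D f) * (Real.exp (δ * ((ℓ : ℝ) + 3)) * Real.exp (-(δ * (geomT D).dist (blkV1 hN D f) (β hN D hk i')))))) := by
        rw [Finset.sum_const, nsmul_eq_mul]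
    _ ≤ ((((ℓ + 1 : ℕ) : ℝ) ^ (d + 1)) ^ j')⁻¹ * ((2 * (((ℓ + 1 : ℕ) : ℝ)) ^ (d + 1)) *
          (F (blkV1 hN D f) * (Real.exp (δ * ((ℓ : ℝ) + 3)) * Real.exp (-(δ * (geomT D).dist (blkV1 hN D f) (β hN D hk i')))))) := by
        refine mul_le_mul_of_nonneg_left (mul_le_mul_of_nonneg_right hcard ?_) hB
        positivity
    _ = _ := by ring

/-- **A SUM OVER THE INDEX BONDS IS A SUM OVER THEIR CARRIER BLOCKS, UP TO `2D`** (at most `2D` index bonds share a carrier block).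
[cite: Balaban1984PropagatorsII, (2.45) p.231, (2.150) p.249, bookkeeping] -/
theorem sum_comp_beta_le (hk1 : 1 ≤ k) {g : ↥(bset D.toDomains) → ℝ} (hg : ∀ y, 0 ≤ g y) :
    ∑ c' : BondIdx (domT hN D hk), g (β hN D hk c') ≤ 2 * ((d : ℝ) + 1) * ∑ y, g y := by
  classical
  rw [Finset.sum_comp]
  calc ∑ y' ∈ Finset.univ.image (β hN D hk), (Finset.univ.filter fun i' => β hN D hk i' = y').card • g y'
      ≤ ∑ y' ∈ Finset.univ.image (β hN D hk), (2 * ((d : ℝ) + 1)) * g y' := Finset.sum_le_sum fun y' _ => by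
        rw [nsmul_eq_mul]
        refine mul_le_mul_of_nonneg_right ?_ (hg y')
        exact_mod_cast card_fiber_beta_le hN D hk hk1 y'
    _ ≤ ∑ y', (2 * ((d : ℝ) + 1)) * g y' :=
        Finset.sum_le_sum_of_subset_of_nonneg (Finset.subset_univ _) fun y' _ _ => by have := hg y'; positivity
    _ = 2 * ((d : ℝ) + 1) * ∑ y', g y' := by rw [Finset.mul_sum]

/-- **(2.63) WITH TWO FACTORS**: `Σ_{y″} e^{−δ₀d(y,y″)}e^{−δ₀d(y″,y′)} ≤ c²·e^{−(1−α)δ₀d(y,y′)}` (the closed chain with one intermediate point).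
[cite: Balaban1984PropagatorsII, Lemma 2.1 (2.63) p.234] -/
theorem conv_two_le {c δ₀ α : ℝ} (h263 : Ineq263With c (geomT D) δ₀ α) (y y' : ↥(bset D.toDomains)) :
    ∑ y'', Real.exp (-(δ₀ * (geomT D).dist y y'')) * Real.exp (-(δ₀ * (geomT D).dist y'' y')) ≤
      c ^ 2 * Real.exp (-((1 - α) * δ₀ * (geomT D).dist y y')) := by
  have h := h263 1 y y'
  simpa [chain_succ, chain_zero] using h

end Sums

/-! ## §5  The composition step: the entry of `T·Q*(QGQ*)⁻¹` from a majorant of `T` and the (2.149)-entries -/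

section Core

variable (hN : ∀ μ, N0 ℓ Mh k P' μ = (PV d ℓ m K hd hL).sitesPerDir 0) (D : TDomains d ℓ Mh k P' R) (hk : k ≤ m + K)
variable {cf : ℝ} (hcf : cf ≠ 0) {w : BondIdx (domT hN D hk) → ℝ} (hw : ∀ i, 0 < w i)

/-- **THE COMPOSITION STEP OF COROLLARY 2.8** (the route "Prop. 2.6 ∘ Prop. 2.7 via Lemma 2.1" of the tree's abstract `B6Cor28`, generic in the left factor): a majorant `F(y)·e^{−δ₃d_T}` (`F ≥ 0`) of an
operator `T` of the fine bond functions, the (2.149) entries `|⟪e_{c′}, (QGQ*)⁻¹e_c⟫| ≤ Λ_{c′}⁻¹Λ_c⁻¹·C_γ·e^{−δ d_T(β c′, β c)}` with `0 < δ ≤ δ₃`, the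
absorption threshold `L^{D+2}e^{−(δ/2)(R·L·M_h − 1)} ≤ 1` and (2.63) at rate `δ/2` give, for every index bond `c` and fine bond `f`:
`|(TQ*(QGQ*)⁻¹e_c)(f)| ≤ (F(y(f))/pref(y(f)))·C_γ·(2L^D·e^{δ₃(ℓ+3)})·L²·L^{D+2}·2D·c²·e^{−(1−α′)(δ/2)d_T(y(f), β c)}` — of the three level factors
(output `F(y)`, middle `L^{−j′D}`, input `Λ⁻¹Λ⁻¹`) only the OUTPUT ratio `F/pref = F/(L^jη)²` survives.
[cite: Balaban1984PropagatorsII, Cor. 2.8 (2.150)–(2.151) p.249, (2.136) p.247, (2.149) p.249, (2.60)/(2.63) p.234, (2.88) p.238] -/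
theorem comp_entry_le (hk1 : 1 ≤ k) (hRM : 2 ≤ R * Mh) (hMh : 1 ≤ Mh) (hP : ∀ μ, 1 ≤ P' μ)
    {T : Module.End ℝ (PBond (PV d ℓ m K hd hL) 0 → ℝ)} {F : ↥(bset D.toDomains) → ℝ}
    {δ₃ Cγ δ c63 α' : ℝ} (hF : ∀ y, 0 ≤ F y) (hCγ : 0 ≤ Cγ) (hδ : 0 < δ) (hδ3 : δ ≤ δ₃)
    (hT : HasMajorant (g := geomT D) (blkV1 hN D) T (fun y y' => F y * Real.exp (-(δ₃ * (geomT D).dist y y'))))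
    (h2149 : ∀ c' c : BondIdx (domT hN D hk),
      |⟪EuclideanSpace.single c' (1 : ℝ), EE (domT hN D hk) hcf hw (EuclideanSpace.single c (1 : ℝ))⟫_ℝ| ≤
        (lam hN D hk cf c')⁻¹ * (lam hN D hk cf c)⁻¹ * (Cγ * Real.exp (-(δ * (geomT D).dist (β hN D hk c') (β hN D hk c)))))
    (hsmall : ((ℓ : ℝ) + 1) ^ (d + 3) * Real.exp (-(δ / 2 * ((R : ℝ) * (((ℓ : ℝ) + 1) * Mh) - 1))) ≤ 1)
    (h263 : Ineq263With c63 (geomT D) (δ / 2) α')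
    (c : BondIdx (domT hN D hk)) (f : PBond (PV d ℓ m K hd hL) 0) :
    |(T ∘ₗ onFun (QsE (domT hN D hk) ∘ₗ EE (domT hN D hk) hcf hw)) (Pi.single c 1) f| ≤
      F (blkV1 hN D f) / pref cf (blkV1 hN D f) *
        (Cγ * (2 * (((ℓ + 1 : ℕ) : ℝ)) ^ (d + 1) * Real.exp (δ₃ * ((ℓ : ℝ) + 3))) * ((ℓ : ℝ) + 1) ^ 2 * ((ℓ : ℝ) + 1) ^ (d + 3) *
          (2 * ((d : ℝ) + 1)) * c63 ^ 2) * Real.exp (-((1 - α') * (δ / 2) * (geomT D).dist (blkV1 hN D f) (β hN D hk c))) := by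
  have hδ3' : 0 ≤ δ₃ := hδ.le.trans hδ3
  have hRM1 : 1 ≤ R * ((ℓ + 1) * Mh) := by
    have h1 : R * Mh ≤ R * ((ℓ + 1) * Mh) := Nat.mul_le_mul_left R (Nat.le_mul_of_pos_left Mh (Nat.succ_pos ℓ))
    omega
  set yf := blkV1 hN D f with hyf
  set Lr : ℝ := (ℓ : ℝ) + 1 with hLr
  set CG : ℝ := 2 * (((ℓ + 1 : ℕ) : ℝ)) ^ (d + 1) * Real.exp (δ₃ * ((ℓ : ℝ) + 3)) with hCG
  have hCG0 : 0 ≤ CG := by positivity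
  have hpf := pref_pos D hcf yf
  set Φ : ℝ := F yf / pref cf yf with hΦ
  have hΦ0 : 0 ≤ Φ := div_nonneg (hF _) hpf.le
  set C₂ : ℝ := Φ * (Cγ * CG * Lr ^ 2 * Lr ^ (d + 3)) with hC₂
  have hC₂0 : 0 ≤ C₂ := by positivity
  -- the smaller threshold for the output factor
  have hsmall2 : Lr ^ 2 * Real.exp (-(δ / 2 * ((R : ℝ) * (Lr * Mh) - 1))) ≤ 1 := by
    refine le_trans (mul_le_mul_of_nonneg_right ?_ (Real.exp_pos _).le) hsmall
    exact pow_le_pow_right₀ (one_le_L (ℓ := ℓ)) (by omega)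
  -- THE PER-TERM BOUND
  have hterm : ∀ c' : BondIdx (domT hN D hk),
      |⟪EuclideanSpace.single c' (1 : ℝ), EE (domT hN D hk) hcf hw (EuclideanSpace.single c (1 : ℝ))⟫_ℝ * T (qwt hN D hk c') f| ≤
        C₂ * (Real.exp (-(δ / 2 * (geomT D).dist yf (β hN D hk c'))) * Real.exp (-(δ / 2 * (geomT D).dist (β hN D hk c') (β hN D hk c)))) := by
    intro c'
    set d₁ := (geomT D).dist yf (β hN D hk c') with hd₁
    set d₂ := (geomT D).dist (β hN D hk c') (β hN D hk c) with hd₂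
    have hd₁0 : 0 ≤ d₁ := distT_nonneg (D := D) _ _
    have hd₂0 : 0 ≤ d₂ := distT_nonneg (D := D) _ _
    have hlc := lam_pos hN D hk hcf c
    have hlc' := lam_pos hN D hk hcf c'
    -- the two factors
    have hE := h2149 c' c
    have hG := abs_apply_qwt_le_gen hN D hk hk1 hRM hMh hP hF hδ3' hT c' f
    rw [abs_mul]
    have hFpos : 0 ≤ F yf := hF _
    have hpref' := pref_pos D hcf (β hN D hk c')
    -- combine: |E|·|Tq| ≤ Cγ·CG · [F(y_f)·V⁻¹·Λ⁻¹(c′)·Λ⁻¹(c)] · e^{−δ₃d₁}·e^{−δd₂}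
    have hprod : |⟪EuclideanSpace.single c' (1 : ℝ), EE (domT hN D hk) hcf hw (EuclideanSpace.single c (1 : ℝ))⟫_ℝ| * |T (qwt hN D hk c') f| ≤
        Cγ * CG * (F yf * (((((ℓ + 1 : ℕ) : ℝ) ^ (d + 1)) ^ (lvl hN D hk c'))⁻¹ * (lam hN D hk cf c')⁻¹) * (lam hN D hk cf c)⁻¹) *
          (Real.exp (-(δ₃ * d₁)) * Real.exp (-(δ * d₂))) := by
      have h := mul_le_mul hE hG (abs_nonneg _) (by positivity)
      refine h.trans (le_of_eq ?_)
      rw [hCG]; ring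
    rw [volInv_mul_lamInv_eq hN D hk hk1 hcf c'] at hprod
    -- the level factors absorbed
    have hout : pref cf yf ≤ Lr ^ 2 * Real.exp (δ / 2 * d₁) * pref cf (β hN D hk c') := by
      refine (pref_le_pow_lgap_mul D cf yf (β hN D hk c')).trans ?_
      exact mul_le_mul_of_nonneg_right (powL_lgap_le D hMh hP hRM1 2 (by positivity) hsmall2 yf (β hN D hk c')) hpref'.le
    have hin : lam hN D hk cf c' ≤ Lr ^ (d + 3) * Real.exp (δ / 2 * d₂) * lam hN D hk cf c :=
      lam_le_absorb hN D hk hk1 hMh hP hRM1 hcf hδ.le hsmall c' c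
    have hratio : F yf * (lam hN D hk cf c' / pref cf (β hN D hk c')) * (lam hN D hk cf c)⁻¹ ≤
        Φ * ((Lr ^ 2 * Real.exp (δ / 2 * d₁)) * (Lr ^ (d + 3) * Real.exp (δ / 2 * d₂))) := by
      rw [show F yf * (lam hN D hk cf c' / pref cf (β hN D hk c')) * (lam hN D hk cf c)⁻¹ =
          Φ * ((pref cf yf / pref cf (β hN D hk c')) * (lam hN D hk cf c' / lam hN D hk cf c)) by rw [hΦ]; field_simp]
      refine mul_le_mul_of_nonneg_left ?_ hΦ0
      refine mul_le_mul ?_ ?_ (by positivity) (by positivity)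
      · rw [div_le_iff₀ hpref']; exact hout
      · rw [div_le_iff₀ hlc]; exact hin
    -- the rates: `δ₃ ≥ δ`
    have hrate : Real.exp (-(δ₃ * d₁)) ≤ Real.exp (-(δ * d₁)) := Real.exp_le_exp.2 (by nlinarith)
    calc |⟪EuclideanSpace.single c' (1 : ℝ), EE (domT hN D hk) hcf hw (EuclideanSpace.single c (1 : ℝ))⟫_ℝ| * |T (qwt hN D hk c') f|
        ≤ Cγ * CG * (F yf * (lam hN D hk cf c' / pref cf (β hN D hk c')) * (lam hN D hk cf c)⁻¹) *
            (Real.exp (-(δ₃ * d₁)) * Real.exp (-(δ * d₂))) := hprod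
      _ ≤ Cγ * CG * (Φ * ((Lr ^ 2 * Real.exp (δ / 2 * d₁)) * (Lr ^ (d + 3) * Real.exp (δ / 2 * d₂)))) *
            (Real.exp (-(δ * d₁)) * Real.exp (-(δ * d₂))) := by
          refine mul_le_mul (mul_le_mul_of_nonneg_left hratio (by positivity)) (mul_le_mul_of_nonneg_right hrate (Real.exp_pos _).le)
            (by positivity) (by positivity)
      _ = C₂ * (Real.exp (-(δ / 2 * d₁)) * Real.exp (-(δ / 2 * d₂))) := by
          rw [hC₂]
          have e1 : Real.exp (δ / 2 * d₁) * Real.exp (-(δ * d₁)) = Real.exp (-(δ / 2 * d₁)) := by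
            rw [← Real.exp_add]; congr 1; ring
          have e2 : Real.exp (δ / 2 * d₂) * Real.exp (-(δ * d₂)) = Real.exp (-(δ / 2 * d₂)) := by
            rw [← Real.exp_add]; congr 1; ring
          calc Cγ * CG * (Φ * ((Lr ^ 2 * Real.exp (δ / 2 * d₁)) * (Lr ^ (d + 3) * Real.exp (δ / 2 * d₂)))) *
                (Real.exp (-(δ * d₁)) * Real.exp (-(δ * d₂)))
              = Φ * (Cγ * CG * Lr ^ 2 * Lr ^ (d + 3)) * ((Real.exp (δ / 2 * d₁) * Real.exp (-(δ * d₁))) *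
                  (Real.exp (δ / 2 * d₂) * Real.exp (-(δ * d₂)))) := by ring
            _ = _ := by rw [e1, e2]
  -- THE SUM
  rw [comp_QsE_EE_single_apply]
  refine (Finset.abs_sum_le_sum_abs _ _).trans ?_
  refine (Finset.sum_le_sum fun c' _ => hterm c').trans ?_
  rw [← Finset.mul_sum]
  have hfib := sum_comp_beta_le hN D hk hk1
    (g := fun y'' => Real.exp (-(δ / 2 * (geomT D).dist yf y'')) * Real.exp (-(δ / 2 * (geomT D).dist y'' (β hN D hk c))))
    (fun y'' => by positivity)
  have hconv := conv_two_le D h263 yf (β hN D hk c)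
  calc C₂ * ∑ c', Real.exp (-(δ / 2 * (geomT D).dist yf (β hN D hk c'))) * Real.exp (-(δ / 2 * (geomT D).dist (β hN D hk c') (β hN D hk c)))
      ≤ C₂ * (2 * ((d : ℝ) + 1) * ∑ y'', Real.exp (-(δ / 2 * (geomT D).dist yf y'')) * Real.exp (-(δ / 2 * (geomT D).dist y'' (β hN D hk c)))) :=
        mul_le_mul_of_nonneg_left hfib hC₂0
    _ ≤ C₂ * (2 * ((d : ℝ) + 1) * (c63 ^ 2 * Real.exp (-((1 - α') * (δ / 2) * (geomT D).dist yf (β hN D hk c))))) :=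
        mul_le_mul_of_nonneg_left (mul_le_mul_of_nonneg_left hconv (by positivity)) hC₂0
    _ = _ := by rw [hC₂, hCG, hLr]; ring

/-- **THE ENTRY OF `H`** (`T = G` with the (2.136)₁ majorant `A·pref·e^{−δ₃d_T}`): the output ratio is the constant `A` — NO level factor at all.
[cite: Balaban1984PropagatorsII, Cor. 2.8 (2.151) p.249 (entry `|H(b,c)|`), (2.136) p.247, (2.149) p.249] -/
theorem H_entry_le (hk1 : 1 ≤ k) (hRM : 2 ≤ R * Mh) (hMh : 1 ≤ Mh) (hP : ∀ μ, 1 ≤ P' μ)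
    {A δ₃ Cγ δ c63 α' : ℝ} (hA : 0 ≤ A) (hCγ : 0 ≤ Cγ) (hδ : 0 < δ) (hδ3 : δ ≤ δ₃)
    (hT : HasMajorant (g := geomT D) (blkV1 hN D) (onFun (GE (domT hN D hk) hcf hw))
      (fun y y' => A * pref cf y * Real.exp (-(δ₃ * (geomT D).dist y y'))))
    (h2149 : ∀ c' c : BondIdx (domT hN D hk),
      |⟪EuclideanSpace.single c' (1 : ℝ), EE (domT hN D hk) hcf hw (EuclideanSpace.single c (1 : ℝ))⟫_ℝ| ≤
        (lam hN D hk cf c')⁻¹ * (lam hN D hk cf c)⁻¹ * (Cγ * Real.exp (-(δ * (geomT D).dist (β hN D hk c') (β hN D hk c)))))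
    (hsmall : ((ℓ : ℝ) + 1) ^ (d + 3) * Real.exp (-(δ / 2 * ((R : ℝ) * (((ℓ : ℝ) + 1) * Mh) - 1))) ≤ 1)
    (h263 : Ineq263With c63 (geomT D) (δ / 2) α')
    (c : BondIdx (domT hN D hk)) (f : PBond (PV d ℓ m K hd hL) 0) :
    |(GE (domT hN D hk) hcf hw ∘ₗ QsE (domT hN D hk) ∘ₗ EE (domT hN D hk) hcf hw) (EuclideanSpace.single c (1 : ℝ)) f| ≤
      A * (Cγ * (2 * (((ℓ + 1 : ℕ) : ℝ)) ^ (d + 1) * Real.exp (δ₃ * ((ℓ : ℝ) + 3))) * ((ℓ : ℝ) + 1) ^ 2 * ((ℓ : ℝ) + 1) ^ (d + 3) *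
        (2 * ((d : ℝ) + 1)) * c63 ^ 2) * Real.exp (-((1 - α') * (δ / 2) * (geomT D).dist (blkV1 hN D f) (β hN D hk c))) := by
  have hF : ∀ y : ↥(bset D.toDomains), 0 ≤ A * pref cf (D := D) y := fun y => mul_nonneg hA (pref_nonneg cf y)
  have h := comp_entry_le hN D hk hcf hw hk1 hRM hMh hP (F := fun y => A * pref cf (D := D) y) hF hCγ hδ hδ3 hT h2149 hsmall h263 c f
  have hratio : A * pref cf (blkV1 hN D f) / pref cf (blkV1 hN D f) = A := mul_div_cancel_right₀ A (pref_pos D hcf _).ne'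
  rw [hratio] at h
  have heq : (GE (domT hN D hk) hcf hw ∘ₗ QsE (domT hN D hk) ∘ₗ EE (domT hN D hk) hcf hw) (EuclideanSpace.single c (1 : ℝ)) f =
      (onFun (GE (domT hN D hk) hcf hw) ∘ₗ onFun (QsE (domT hN D hk) ∘ₗ EE (domT hN D hk) hcf hw)) (Pi.single c 1) f := by
    rw [← onFun_comp, onFun_apply, PiLp.toLp_single]
  rw [heq]
  exact h

end Core

/-! ## §6  The two «M sufficiently large» thresholds met -/

section Thresholds

/-- `2 ≤ R·M_h` in the ROUTE-V setting. [cite: Balaban1984PropagatorsII, (2.2) p.224, bookkeeping] -/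
theorem two_le_RMh {ℓ Mh R : ℕ} (hR2 : 2 * (ℓ + 1) ^ 2 ≤ R) (hM8 : 8 ≤ Mh) : 2 ≤ R * Mh := by
  have hR1 : 1 ≤ R := le_trans (Nat.one_le_pow _ _ (by omega)) (le_trans (Nat.le_mul_of_pos_left _ (by norm_num)) hR2)
  calc 2 ≤ 1 * 8 := by norm_num
    _ ≤ R * Mh := Nat.mul_le_mul hR1 hM8

/-- **THE ABSORPTION THRESHOLD MET**: `N ≥ N₃ ≥ 2(d+3)L/δ` gives `L^{D+2}·e^{−(δ/2)N} ≤ 1` (`log L ≤ L`). [cite: Balaban1984PropagatorsII, (2.59) p.233 («RM is sufficiently large»), bookkeeping] -/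
theorem absorb_threshold {d ℓ N₃ : ℕ} {δ N : ℝ} (hδ : 0 < δ) (hN₃ : 2 * ((d : ℝ) + 3) * ((ℓ : ℝ) + 1) ≤ δ * N₃) (hN : (N₃ : ℝ) ≤ N) :
    ((ℓ : ℝ) + 1) ^ (d + 3) * Real.exp (-(δ / 2 * N)) ≤ 1 := by
  have hL0 : (0 : ℝ) < (ℓ : ℝ) + 1 := by positivity
  have hlog : Real.log ((ℓ : ℝ) + 1) ≤ (ℓ : ℝ) + 1 := (Real.log_le_sub_one_of_pos hL0).trans (by linarith)
  have hpow : ((ℓ : ℝ) + 1) ^ (d + 3) ≤ Real.exp (δ / 2 * (N₃ : ℝ)) := by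
    have hlogpow : Real.log (((ℓ : ℝ) + 1) ^ (d + 3)) ≤ δ / 2 * (N₃ : ℝ) := by
      rw [Real.log_pow]; push_cast
      have hd3 : (0 : ℝ) ≤ (d : ℝ) + 3 := by positivity
      nlinarith [mul_le_mul_of_nonneg_left hlog hd3]
    calc ((ℓ : ℝ) + 1) ^ (d + 3) = Real.exp (Real.log (((ℓ : ℝ) + 1) ^ (d + 3))) := (Real.exp_log (by positivity)).symm
      _ ≤ Real.exp (δ / 2 * (N₃ : ℝ)) := Real.exp_le_exp.2 hlogpow
  calc ((ℓ : ℝ) + 1) ^ (d + 3) * Real.exp (-(δ / 2 * N)) ≤ Real.exp (δ / 2 * (N₃ : ℝ)) * Real.exp (-(δ / 2 * N)) :=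
        mul_le_mul_of_nonneg_right hpow (Real.exp_pos _).le
    _ ≤ 1 := by
        rw [← Real.exp_add, Real.exp_le_one_iff]
        have := mul_le_mul_of_nonneg_left hN (by positivity : (0 : ℝ) ≤ δ / 2)
        linarith

/-- **THE (2.63) THRESHOLD MET**: for `N₂ = ⌈64DL/δ⌉ + 1`, `e^{−δ/32}·L^{2D/N₂} < 1` (the (2.59)-shape condition of `lemma21_torus` at rate `δ/2`, `α = 1/16`).
[cite: Balaban1984PropagatorsII, (2.59) p.233, bookkeeping] -/
theorem theta_threshold (d ℓ : ℕ) {δ : ℝ} (hδ : 0 < δ) :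
    0 < ⌈64 * ((d : ℝ) + 1) * ((ℓ : ℝ) + 1) / δ⌉₊ + 1 ∧
    Real.exp (-(1 / 16 * (δ / 2))) * ((ℓ : ℝ) + 1) ^ ((2 * (d + 1 : ℕ) : ℝ) / (⌈64 * ((d : ℝ) + 1) * ((ℓ : ℝ) + 1) / δ⌉₊ + 1 : ℕ)) < 1 := by
  set N₂ : ℕ := ⌈64 * ((d : ℝ) + 1) * ((ℓ : ℝ) + 1) / δ⌉₊ + 1 with hN₂
  have hL0 : (0 : ℝ) < (ℓ : ℝ) + 1 := by positivity
  have hlog : Real.log ((ℓ : ℝ) + 1) ≤ (ℓ : ℝ) + 1 := (Real.log_le_sub_one_of_pos hL0).trans (by linarith)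
  have hN₂pos : 0 < N₂ := Nat.succ_pos _
  have hN₂ge : 64 * ((d : ℝ) + 1) * ((ℓ : ℝ) + 1) < δ * (N₂ : ℝ) := by
    have h1 : 64 * ((d : ℝ) + 1) * ((ℓ : ℝ) + 1) / δ < (N₂ : ℝ) := by
      rw [hN₂]; push_cast; exact lt_of_le_of_lt (Nat.le_ceil _) (by linarith)
    rw [div_lt_iff₀ hδ] at h1; linarith
  refine ⟨hN₂pos, theta_lt_one_of_log hL0 hN₂pos ?_⟩
  push_cast
  have hd0 : (0 : ℝ) ≤ 2 * ((d : ℝ) + 1) := by positivity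
  nlinarith [mul_le_mul_of_nonneg_left hlog hd0]

end Thresholds

/-! ## §7  Corollary 2.8 (2.151)₁ for the genuine `H` at k levels, modulo the level-weighted (2.147) -/

section Modulo2147

/-- **[B6] COROLLARY 2.8, THE ENTRY `|H(b, c)|` OF (2.151), AT k LEVELS FOR THE GENUINE `H = GQ*(QGQ*)⁻¹ = GE ∘ QsE ∘ EE`, MODULO THE LEVEL-WEIGHTED
(2.147)** (binders of `B6Prop27KLevelV1.prop27_kLevel` verbatim — in particular its ONE displayed hypothesis, the coercivity (2.147)
`γΣ_iΛ_i²v_i² ≤ ⟪Q*v, GQ*v⟫` with a free `γ > 0` on which the constants depend — the thresholds `M₂`, `N₁` enlarged): for every `σ ∈ (0, σ₁]`,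
`α ∈ (0, 1)`, `γ > 0` there are `δ₅ > 0`, `C ≥ 0`, `M₂ > 0`, `N₁` such that for every such torus family, weights in the band and `QGQ*` coercive with `γ`,
for EVERY index bond `c` and fine bond `f`: `|(He_c)(f)| ≤ C·e^{−δ₅·d_T(y(f), β c)}`, AND `H` has the two-space majorant `2D·C·e^{−δ₅d_T}`.  Inputs BY NAME:
the landed (2.136)₁ `B6Line3CubeV1.prop26_2136_kLevel_unconditional` and (2.149) modulo (2.147) `B6Prop27KLevelV1.prop27_kLevel`; the discharge of
(2.147) (print's `γ₀` of (2.147)–(2.148), a constant depending on `d`, `L` and the band) is ROUTE W part W1, after which `γ := γ₀` gives the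
hypothesis-free form (sibling file `B6Cor28EntriesKLevelV1`).  `δ₅ = (15/32)·δ₄`, `δ₄ = min(δ₃/4, (γ/A′)/(16D·c/δ₃ + 1))`, `δ₃ = delta3 α (2σ)`.
[cite: Balaban1984PropagatorsII, Cor. 2.8 (2.150)–(2.151) p.249, Prop. 2.6 (2.136) p.247, Prop. 2.7 (2.147)–(2.149) p.248–249, Lemma 2.1 (2.60)–(2.63) p.234] -/
theorem cor28_kLevel_H_of_2147 (d ℓ : ℕ) (hd : 1 ≤ d + 1) (hL : Odd (ℓ + 1) ∧ 1 < ℓ + 1) {b₀ b₁ : ℝ} (hb₀ : 0 < b₀) (hb₁ : b₀ ≤ b₁) :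
    ∃ σ₁ : ℝ, 0 < σ₁ ∧ ∀ (σ : ℝ), 0 < σ → σ ≤ σ₁ → ∀ (α : ℝ), 0 < α → α < 1 → ∀ (γ : ℝ), 0 < γ →
    ∃ (δ₅ C M₂ : ℝ) (N₁ : ℕ), 0 < δ₅ ∧ 0 ≤ C ∧ 0 < M₂ ∧
    ∀ (m K : ℕ) {Mh k R : ℕ} {P' : Fin (d + 1) → ℕ}
      (hN : ∀ μ, N0 ℓ Mh k P' μ = (PV d ℓ m K hd hL).sitesPerDir 0) (D : TDomains d ℓ Mh k P' R) (hk : k ≤ m + K) (_ : 2 ≤ k)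
      {a : ℕ} (_ : Mh = (ℓ + 1) ^ a) (_ : 8 ≤ Mh) (_ : 2 * (ℓ + 1) ^ 2 ≤ R) (_ : ∀ μ, 5 ≤ P' μ) (_ : 4 ≤ ℓ)
      (_ : ∀ c : ↥(cubes D.toDomains), Placed ℓ k P' c.1) (_ : M₂ ≤ ((ℓ : ℝ) + 1) * Mh) (_ : N₁ + 1 ≤ R * ((ℓ + 1) * Mh))
      {cf : ℝ} (hcf : cf ≠ 0) {w : BondIdx (domT hN D hk) → ℝ} (hw : ∀ i, 0 < w i) (_ : GlobalBand b₀ b₁ cf w)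
      (_ : ∀ v : BondIdxSpace (domT hN D hk), γ * ∑ i, wt hN D hk cf i * v i ^ 2 ≤
        ⟪QsE (domT hN D hk) v, GE (domT hN D hk) hcf hw (QsE (domT hN D hk) v)⟫_ℝ),
      (∀ (c : BondIdx (domT hN D hk)) (f : PBond (PV d ℓ m K hd hL) 0),
        |(GE (domT hN D hk) hcf hw ∘ₗ QsE (domT hN D hk) ∘ₗ EE (domT hN D hk) hcf hw) (EuclideanSpace.single c (1 : ℝ)) f| ≤
          C * Real.exp (-(δ₅ * (geomT D).dist (blkV1 hN D f) (β hN D hk c)))) ∧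
      HasMajorantHom (g := geomT D) (β hN D hk) (blkV1 hN D) (onFun (GE (domT hN D hk) hcf hw ∘ₗ QsE (domT hN D hk) ∘ₗ EE (domT hN D hk) hcf hw))
        (fun y y' => 2 * ((d : ℝ) + 1) * C * Real.exp (-(δ₅ * (geomT D).dist y y'))) := by
  obtain ⟨σ₁, hσ₁, h26⟩ := B6Line3CubeV1.prop26_2136_kLevel_unconditional d ℓ hd hL hb₀ hb₁
  obtain ⟨σ₂, hσ₂, h27⟩ := B6Prop27KLevelV1.prop27_kLevel d ℓ hd hL hb₀ hb₁
  refine ⟨min σ₁ σ₂, lt_min hσ₁ hσ₂, fun σ hσ hσ1 α hα hα1 γ hγ0 => ?_⟩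
  obtain ⟨A, M₂, hA, hM₂, hG⟩ := h26 σ hσ (hσ1.trans (min_le_left _ _)) α hα hα1.le
  obtain ⟨A', M₂', c, N₁, hA', hM₂', hc, hEE⟩ := h27 σ hσ (hσ1.trans (min_le_right _ _)) α hα hα1
  clear h26 h27
  -- the rates
  set δ₃ : ℝ := delta3 α (2 * σ) with hδ₃
  have hδ₃pos : 0 < δ₃ := B6RandomWalk.delta3_pos hα1 (by linarith)
  set δ₄ : ℝ := min (δ₃ / 4) (γ / A' / (2 * (1 * (4 / δ₃) * (2 * ((d : ℝ) + 1) * c)) + 1)) with hδ₄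
  have hδ₄pos : 0 < δ₄ := by
    rw [hδ₄]
    refine lt_min (by linarith) (div_pos (div_pos hγ0 hA') ?_)
    have : 0 ≤ 2 * (1 * (4 / δ₃) * (2 * ((d : ℝ) + 1) * c)) := by positivity
    linarith
  have hδ₄le : δ₄ ≤ δ₃ := (min_le_left _ _).trans (by linarith)
  -- the threshold of (2.63) on the torus at rate `δ₄/2`, `α′ = 1/16`
  obtain ⟨hN₂pos, hθ⟩ := theta_threshold d ℓ hδ₄pos
  set N₂ : ℕ := ⌈64 * ((d : ℝ) + 1) * ((ℓ : ℝ) + 1) / δ₄⌉₊ + 1 with hN₂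
  set c63 : ℝ := K261 N₂ (d + 1) ((ℓ : ℝ) + 1) 1 (1 / 16 * (δ₄ / 2)) with hc63
  -- the absorption threshold `N₃ ≥ 2(d+3)L/δ₄`
  obtain ⟨N₃, hN₃⟩ : ∃ N₃ : ℕ, N₃ = ⌈2 * ((d : ℝ) + 3) * ((ℓ : ℝ) + 1) / δ₄⌉₊ + 1 := ⟨_, rfl⟩
  have hN₃ge : 2 * ((d : ℝ) + 3) * ((ℓ : ℝ) + 1) ≤ δ₄ * (N₃ : ℝ) := by
    have h1 : 2 * ((d : ℝ) + 3) * ((ℓ : ℝ) + 1) / δ₄ ≤ (N₃ : ℝ) := by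
      rw [hN₃]; push_cast; exact (Nat.le_ceil _).trans (by linarith)
    rw [div_le_iff₀ hδ₄pos] at h1; linarith
  -- constants
  set C : ℝ := A * (2 / γ * (2 * (((ℓ + 1 : ℕ) : ℝ)) ^ (d + 1) * Real.exp (δ₃ * ((ℓ : ℝ) + 3))) * ((ℓ : ℝ) + 1) ^ 2 *
    ((ℓ : ℝ) + 1) ^ (d + 3) * (2 * ((d : ℝ) + 1)) * c63 ^ 2) with hC
  have hc63_0 : 0 ≤ c63 := K261_nonneg (by positivity) zero_le_one
  have hC0 : 0 ≤ C := by positivity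
  refine ⟨(1 - 1 / 16) * (δ₄ / 2), C, max M₂ M₂', max (max N₁ N₂) N₃, by positivity, hC0, lt_max_of_lt_left hM₂, ?_⟩
  intro m K Mh k R P' hN D hk hk2 a hMha hM8 hR2 hP5 hℓ hpl hM hRM cf hcf w hw hwb hγ
  have hk1 : 1 ≤ k := le_trans one_le_two hk2
  have hMh : 1 ≤ Mh := le_trans (by norm_num) hM8
  have hP : ∀ μ, 1 ≤ P' μ := fun μ => le_trans (by norm_num) (hP5 μ)
  have hRM2 : 2 ≤ R * Mh := two_le_RMh hR2 hM8
  -- the two inputs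
  have hT := hG m K hN D hk hk2 hMha hM8 hR2 hP5 hℓ hpl ((le_max_left _ _).trans hM) hcf hw hwb
  have h2149 := hEE m K hN D hk hk2 hMha hM8 hR2 hP5 hℓ hpl ((le_max_right _ _).trans hM)
    (le_trans (Nat.succ_le_succ ((le_max_left _ _).trans (le_max_left _ _))) hRM) hcf hw hwb hγ0 hγ
  clear hG hEE
  -- (2.63) on the torus at rate `δ₄/2`, `α′ = 1/16`
  have hRM2' : N₂ + 1 ≤ R * ((ℓ + 1) * Mh) := le_trans (Nat.succ_le_succ ((le_max_right _ _).trans (le_max_left _ _))) hRM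
  obtain ⟨-, -, -, h263⟩ := lemma21_torus D hMh hP hN₂pos hRM2' (δ₀ := δ₄ / 2) (α := 1 / 16) (by positivity) (by norm_num) (by norm_num) hθ
  -- the absorption threshold
  have hN₃le : (N₃ : ℝ) ≤ (R : ℝ) * (((ℓ : ℝ) + 1) * Mh) - 1 := by
    have h1 : N₃ + 1 ≤ R * ((ℓ + 1) * Mh) := le_trans (Nat.succ_le_succ (le_max_right _ _)) hRM
    have h2 : ((N₃ + 1 : ℕ) : ℝ) ≤ ((R * ((ℓ + 1) * Mh) : ℕ) : ℝ) := by exact_mod_cast h1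
    push_cast at h2; linarith
  have hsmall : ((ℓ : ℝ) + 1) ^ (d + 3) * Real.exp (-(δ₄ / 2 * ((R : ℝ) * (((ℓ : ℝ) + 1) * Mh) - 1))) ≤ 1 :=
    absorb_threshold hδ₄pos hN₃ge hN₃le
  -- the entry bound
  have hent : ∀ (c' : BondIdx (domT hN D hk)) (f : PBond (PV d ℓ m K hd hL) 0),
      |(GE (domT hN D hk) hcf hw ∘ₗ QsE (domT hN D hk) ∘ₗ EE (domT hN D hk) hcf hw) (EuclideanSpace.single c' (1 : ℝ)) f| ≤
        C * Real.exp (-((1 - 1 / 16) * (δ₄ / 2) * (geomT D).dist (blkV1 hN D f) (β hN D hk c'))) := by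
    intro c' f
    have h := H_entry_le hN D hk hcf hw hk1 hRM2 hMh hP hA (by positivity : (0 : ℝ) ≤ 2 / γ) hδ₄pos hδ₄le
      hT (fun x x' => h2149 x x') hsmall h263 c' f
    rw [hC]
    exact h
  refine ⟨hent, ?_⟩
  -- the two-space majorant form
  refine hasMajorantHom_of_entries (g := geomT D) (β hN D hk) (blkV1 hN D) _ _ fun f y' s hs => ?_
  classical
  have hsub : s ⊆ Finset.univ.filter (fun i' : BondIdx (domT hN D hk) => β hN D hk i' = y') :=
    fun i' hi' => Finset.mem_filter.2 ⟨Finset.mem_univ _, hs i' hi'⟩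
  have hcard : (s.card : ℝ) ≤ 2 * ((d : ℝ) + 1) := by
    have h3 : s.card ≤ 2 * (d + 1) := (Finset.card_le_card hsub).trans (card_fiber_beta_le hN D hk hk1 y')
    exact_mod_cast h3
  calc ∑ x ∈ s, |(GE (domT hN D hk) hcf hw ∘ₗ QsE (domT hN D hk) ∘ₗ EE (domT hN D hk) hcf hw) (EuclideanSpace.single x (1 : ℝ)) f|
      ≤ ∑ x ∈ s, C * Real.exp (-((1 - 1 / 16) * (δ₄ / 2) * (geomT D).dist (blkV1 hN D f) y')) :=
        Finset.sum_le_sum fun x hx => by rw [← hs x hx]; exact hent x f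
    _ = s.card * (C * Real.exp (-((1 - 1 / 16) * (δ₄ / 2) * (geomT D).dist (blkV1 hN D f) y'))) := by
        rw [Finset.sum_const, nsmul_eq_mul]
    _ ≤ 2 * ((d : ℝ) + 1) * (C * Real.exp (-((1 - 1 / 16) * (δ₄ / 2) * (geomT D).dist (blkV1 hN D f) y'))) :=
        mul_le_mul_of_nonneg_right hcard (by positivity)
    _ = _ := by ring

end Modulo2147

end

end Literature.MathematicalPhysics.QuantumFieldTheory.Balaban1983to89.B6Cor28KLevelV1
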